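import Mathlib.Data.Real.Basic
import Mathlib.Tactic
import HarnessLib

/-!
# The algebra of relative agreement behind the cell's engine-pair and grid-pair arithmetic

Cell `pub-fluidc` (FLUID COMPUTER; host summit `NavierStokesRegularity`, negation side, machine paradigm), prover
seat p1 (gen 7) — the second-engine seat. HONEST FRAMING: low prior, high value-of-information experiment on Tao's
machine paradigm; NOT a claim that NS blows up. Nothing here is about the Navier–Stokes equations.

Every certification line of the cell is a statement `|x − x_ref| ≤ ε · |x_ref|` between two engines at matched `N`
or two grids of one engine (RULING R25 (iii): `ε = 2 %` on `g_pk` and `G(t_pk,U)`; LEAD WORD l.4790 / l.4830), and the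
readings are then COMPOSED: a third engine is compared through the second (rows (a), (b), (e) carry three engines),
a grid step is stacked on an engine step (256³ pair → 384³ leg), and the band amplitude is a product
`g = Π · G · κ₀` (`FluidComputer.BandSupOvershoot`) whose factors are certified separately. This file records the
exact inequalities those compositions use, so that a composed tolerance is computed, not guessed:

* `RelWithin ε x ref` — `|x − ref| ≤ ε · |ref|`;
* `RelWithin.symm'` — swapping the reference costs `ε ↦ ε/(1 − ε)` (`ε < 1`);
* `RelWithin.trans'` — chaining two agreements costs `ε₁ + ε₂ + ε₁ ε₂` (NOT `ε₁ + ε₂`);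
* `RelWithin.mul` — a product of separately certified factors is certified to `ε₁ + ε₂ + ε₁ ε₂`;
* `RelWithin.abs_ref_le` / `le_abs_ref` — the reference is recovered from the reading up to `1 ± ε`;
* the cell's instances: two `2 %` steps compose to `4.04 %` (`two_percent_twice`), and a `2 %` agreement read the
  other way round is a `2.0409 %` one (`two_percent_symm`).
0 sorry; no named fact introduced.
-/

namespace Summit.NavierStokesRegularity.FluidComputer.RelativeAgreement

/-- Relative agreement of a reading `x` with a reference `ref` at tolerance `ε`: `|x − ref| ≤ ε · |ref|`. -/
def RelWithin (ε x ref : ℝ) : Prop := |x - ref| ≤ ε * |ref|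

namespace RelWithin

/-- A reading agrees with itself at every non-negative tolerance. -/
theorem refl' {ε : ℝ} (hε : 0 ≤ ε) (x : ℝ) : RelWithin ε x x := by
  unfold RelWithin; simp only [sub_self, abs_zero]; positivity

/-- Loosening the tolerance preserves agreement. -/
theorem mono {ε ε' x ref : ℝ} (h : RelWithin ε x ref) (hε : ε ≤ ε') : RelWithin ε' x ref :=
  h.trans (mul_le_mul_of_nonneg_right hε (abs_nonneg _))

/-- The reading is at most `(1 + ε)` times the reference in size. -/
theorem abs_le {ε x ref : ℝ} (h : RelWithin ε x ref) : |x| ≤ (1 + ε) * |ref| := by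
  unfold RelWithin at h
  have := abs_sub_abs_le_abs_sub x ref
  linarith

/-- The reference is at most `|x| / (1 − ε)`: `(1 − ε) |ref| ≤ |x|`. -/
theorem le_abs_ref {ε x ref : ℝ} (h : RelWithin ε x ref) : (1 - ε) * |ref| ≤ |x| := by
  unfold RelWithin at h
  have := abs_sub_abs_le_abs_sub ref x
  rw [abs_sub_comm] at this
  linarith

/-- SWAPPING THE REFERENCE: if `x` agrees with `ref` to `ε < 1`, then `ref` agrees with `x` to `ε/(1 − ε)`. -/
theorem symm' {ε x ref : ℝ} (hε0 : 0 ≤ ε) (hε : ε < 1) (h : RelWithin ε x ref) :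
    RelWithin (ε / (1 - ε)) ref x := by
  have hlow := h.le_abs_ref
  unfold RelWithin at h ⊢
  rw [abs_sub_comm]
  have h1 : 0 < 1 - ε := by linarith
  -- |x - ref| ≤ ε |ref| ≤ ε |x| / (1 - ε)
  have href : |ref| ≤ |x| / (1 - ε) := by
    rw [le_div_iff₀ h1]; linarith
  calc |x - ref| ≤ ε * |ref| := h
    _ ≤ ε * (|x| / (1 - ε)) := mul_le_mul_of_nonneg_left href hε0
    _ = ε / (1 - ε) * |x| := by ring

/-- CHAINING: `x` agrees with `y` to `ε₁` and `y` with `z` to `ε₂` ⟹ `x` agrees with `z` to `ε₁ + ε₂ + ε₁ ε₂`. -/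
theorem trans' {ε₁ ε₂ x y z : ℝ} (hε₁ : 0 ≤ ε₁) (h1 : RelWithin ε₁ x y) (h2 : RelWithin ε₂ y z) :
    RelWithin (ε₁ + ε₂ + ε₁ * ε₂) x z := by
  have hy := h2.abs_le
  unfold RelWithin at h1 h2 ⊢
  have htri : |x - z| ≤ |x - y| + |y - z| := abs_sub_le x y z
  have h1' : |x - y| ≤ ε₁ * ((1 + ε₂) * |z|) := h1.trans (mul_le_mul_of_nonneg_left hy hε₁)
  calc |x - z| ≤ ε₁ * ((1 + ε₂) * |z|) + ε₂ * |z| := by linarith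
    _ = (ε₁ + ε₂ + ε₁ * ε₂) * |z| := by ring

/-- PRODUCTS: factors certified to `ε₁`, `ε₂` give a product certified to `ε₁ + ε₂ + ε₁ ε₂`
(`g = Π · G · κ₀`: the band amplitude inherits the composed tolerance of its dictionary factors). -/
theorem mul {ε₁ ε₂ a b a₀ b₀ : ℝ} (ha : RelWithin ε₁ a a₀) (hb : RelWithin ε₂ b b₀) :
    RelWithin (ε₁ + ε₂ + ε₁ * ε₂) (a * b) (a₀ * b₀) := by
  have hab := ha.abs_le
  unfold RelWithin at ha hb ⊢
  have hsplit : a * b - a₀ * b₀ = (a - a₀) * b₀ + a * (b - b₀) := by ring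
  rw [hsplit, abs_mul a₀ b₀]
  have h1 : |(a - a₀) * b₀| ≤ ε₁ * |a₀| * |b₀| := by
    rw [abs_mul]; exact mul_le_mul_of_nonneg_right ha (abs_nonneg _)
  have h2 : |a * (b - b₀)| ≤ (1 + ε₁) * |a₀| * (ε₂ * |b₀|) := by
    rw [abs_mul]
    exact mul_le_mul hab hb (abs_nonneg _) ((abs_nonneg a).trans hab)
  calc |(a - a₀) * b₀ + a * (b - b₀)| ≤ |(a - a₀) * b₀| + |a * (b - b₀)| := abs_add_le _ _
    _ ≤ ε₁ * |a₀| * |b₀| + (1 + ε₁) * |a₀| * (ε₂ * |b₀|) := add_le_add h1 h2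
    _ = (ε₁ + ε₂ + ε₁ * ε₂) * (|a₀| * |b₀|) := by ring

/-- A constant positive rescaling of both reading and reference (change of normalisation, e.g. `r = g/λ`)
does not change relative agreement. -/
theorem smul {ε x ref c : ℝ} (h : RelWithin ε x ref) : RelWithin ε (c * x) (c * ref) := by
  unfold RelWithin at h ⊢
  rw [← mul_sub, abs_mul, abs_mul, mul_left_comm]
  exact mul_le_mul_of_nonneg_left h (abs_nonneg _)

end RelWithin

/-! ### The cell's tolerances -/

/-- Two `2 %` steps (engine → engine → grid, or engine → engine → third engine) compose to `4.04 %`, not `4 %`. -/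
theorem two_percent_twice {x y z : ℝ} (h1 : RelWithin 0.02 x y) (h2 : RelWithin 0.02 y z) :
    RelWithin 0.0404 x z := by
  have h : (0.02 + 0.02 + 0.02 * 0.02 : ℝ) = 0.0404 := by norm_num
  exact h ▸ RelWithin.trans' (by norm_num) h1 h2

/-- A `2 %` agreement read with the roles of reading and reference swapped is a `0.02/0.98 < 2.041 %` agreement. -/
theorem two_percent_symm {x ref : ℝ} (h : RelWithin 0.02 x ref) : RelWithin 0.02041 ref x := by
  have := RelWithin.symm' (by norm_num) (by norm_num) h
  norm_num at this
  exact this.mono (by norm_num)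

/-- The three-currency product at the cell's digits: factors `Π` and `G` each certified to `2 %` certify `Π · G` to
`4.04 %`; with `κ₀` exact (same field) the band amplitude `g = Π · G · κ₀` carries the same `4.04 %`. -/
theorem product_two_percent {P G P₀ G₀ κ : ℝ} (hP : RelWithin 0.02 P P₀) (hG : RelWithin 0.02 G G₀) :
    RelWithin 0.0404 (κ * (P * G)) (κ * (P₀ * G₀)) := by
  have h : (0.02 + 0.02 + 0.02 * 0.02 : ℝ) = 0.0404 := by norm_num
  exact h ▸ (RelWithin.mul hP hG).smul

/-! ### Instance: the u0⁽²⁾ engine pair of 2026-08-25 at 256³ (HOME/STATUS l.4853 dns-B RESULT, l.4857 p1 X-ENGINE line)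

Level-one readings of the pass-3 stage-2 design `R3A-192-band34-bsgain-p12-rho3-T2-ws-1` at `ν₀/3`, each engine at its
own peak: p1spec + r3fwd 256³ twin (kit j227241) `g_pk = 3.86979`, `G(t_pk,U) = 2.05717`; dns-B 0.4.0 256³ leg (kit
j229326) `3.86980`, `2.05772`; opt-adj's own kernel at 192³ (horizon leg, kit j227217) `g_pk = 3.87020`. The words
('certified', the 384³ trigger) are the LEAD's; below is only the arithmetic, at the tolerances the digits support. -/

/-- p1spec 256³: `g_pk`. -/
def gP1 : ℝ := 3.86979
/-- dns-B 256³: `g_pk`. -/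
def gDnsB : ℝ := 3.86980
/-- opt-adj kernel 192³ (horizon leg): `g_pk` at its own `t_pk,U`. -/
def gOpt192 : ℝ := 3.87020
/-- p1spec 256³: `G(t_pk,U)`. -/
def GP1 : ℝ := 2.05717
/-- dns-B 256³: `G(t_pk,U)`. -/
def GDnsB : ℝ := 2.05772

/-- The matched-N engine pair agrees to `3·10⁻⁶` on `g_pk` and `3·10⁻⁴` on `G(t_pk,U)` (reference = p1spec, as in the
LEAD's trigger l.4790) — hence, a fortiori, to the trigger's `2 %` on both. -/
theorem u02_pair_level_one :
    (RelWithin 3e-6 gDnsB gP1 ∧ RelWithin 3e-4 GDnsB GP1) ∧ (RelWithin 0.02 gDnsB gP1 ∧ RelWithin 0.02 GDnsB GP1) := by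
  have h1 : RelWithin 3e-6 gDnsB gP1 := by
    unfold RelWithin gDnsB gP1; rw [abs_of_pos (by norm_num : (0:ℝ) < 3.86979)]; norm_num [abs_le]
  have h2 : RelWithin 3e-4 GDnsB GP1 := by
    unfold RelWithin GDnsB GP1; rw [abs_of_pos (by norm_num : (0:ℝ) < 2.05717)]; norm_num [abs_le]
  exact ⟨⟨h1, h2⟩, ⟨h1.mono (by norm_num), h2.mono (by norm_num)⟩⟩

/-- Third engine, other grid: opt-adj's 192³ own-peak `g_pk` agrees with p1spec's 256³ one to `1.1·10⁻⁴`, and with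
dns-B's to `1.2·10⁻⁴` — three engines on two grids inside `1.2·10⁻⁴` on the level-one amplitude (INFORMATION: the
192³ number is a cross-grid datum, not a matched-N certificate). -/
theorem u02_third_engine : RelWithin 1.1e-4 gOpt192 gP1 ∧ RelWithin 1.2e-4 gDnsB gOpt192 := by
  constructor
  · unfold RelWithin gOpt192 gP1; rw [abs_of_pos (by norm_num : (0:ℝ) < 3.86979)]; norm_num [abs_le]
  · unfold RelWithin gDnsB gOpt192; rw [abs_of_pos (by norm_num : (0:ℝ) < 3.87020)]; norm_num [abs_le]

/-! ### Signed windows, floors and the reading below a floor (p1 gen 8)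

For a non-negative reference an agreement is the signed window `(1 − ε)·ref ≤ x ≤ (1 + ε)·ref`. Two consequences the
cell's 3N readings use: a FLOOR `F` passed by the reference with relative margin `m` (`(1 + m)·F ≤ ref`) is passed by
every reading that agrees to a tolerance `ε` with `ε·(1 + m) ≤ m`; and a reading found BELOW `(1 − ε)·ref` refutes the
agreement. Both hold whichever of the two values is called the reference (`lower_of_symm`). -/

namespace RelWithin

/-- Signed lower edge of the window: `(1 − ε)·ref ≤ x` for a non-negative reference. -/
theorem lower {ε x ref : ℝ} (h : RelWithin ε x ref) (href : 0 ≤ ref) : (1 - ε) * ref ≤ x := by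
  unfold RelWithin at h
  rw [abs_of_nonneg href] at h
  have := neg_abs_le (x - ref)
  linarith

/-- Signed upper edge of the window: `x ≤ (1 + ε)·ref` for a non-negative reference. -/
theorem upper {ε x ref : ℝ} (h : RelWithin ε x ref) (href : 0 ≤ ref) : x ≤ (1 + ε) * ref := by
  unfold RelWithin at h
  rw [abs_of_nonneg href] at h
  have := le_abs_self (x - ref)
  linarith

/-- The other convention (difference normalised by the READING, i.e. the roles swapped): a non-negative reading that
the reference agrees with to `ε ≥ 0` is at least `ref/(1 + ε)`. -/
theorem lower_of_symm {ε x ref : ℝ} (h : RelWithin ε ref x) (hx : 0 ≤ x) (hε : 0 ≤ ε) : ref / (1 + ε) ≤ x := by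
  have hu := h.upper hx
  rw [div_le_iff₀ (by linarith)]
  linarith

/-- FLOOR TRANSFER. If the reference passes a floor `F ≥ 0` with relative margin `m`, `(1 + m)·F ≤ ref`, then every
reading agreeing with it to a tolerance `ε ≤ 1` with `ε·(1 + m) ≤ m` (i.e. `ε ≤ m/(1 + m)`) passes the floor too. -/
theorem floor {ε m F x ref : ℝ} (h : RelWithin ε x ref) (hε : ε ≤ 1) (hF : 0 ≤ F) (hm : (1 + m) * F ≤ ref)
    (hεm : ε * (1 + m) ≤ m) : F ≤ x := by
  -- `ε ≤ 1` and `ε(1 + m) ≤ m` force `0 ≤ 1 + m`, hence `0 ≤ ref`.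
  have h1m : 0 ≤ 1 + m := by
    by_contra hneg
    have hlt : 1 + m < 0 := not_le.mp hneg
    nlinarith [mul_nonpos_of_nonneg_of_nonpos (sub_nonneg.mpr hε) hlt.le, hεm]
  have href : 0 ≤ ref := le_trans (mul_nonneg h1m hF) hm
  have hl := h.lower href
  have h1 : (1 - ε) * ((1 + m) * F) ≤ (1 - ε) * ref := mul_le_mul_of_nonneg_left hm (by linarith)
  have h2 : F ≤ (1 - ε) * ((1 + m) * F) := by nlinarith [mul_nonneg (sub_nonneg.mpr hεm) hF]
  linarith

/-- A reading at or above `(1 − ε)·ref` is all the floor transfer uses: `F ≤ (1 − ε)·ref ⟹ F ≤ x`. -/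
theorem floor_of_le_lower {ε F x ref : ℝ} (h : RelWithin ε x ref) (href : 0 ≤ ref) (hF : F ≤ (1 - ε) * ref) :
    F ≤ x :=
  hF.trans (h.lower href)

/-- BELOW THE FLOOR REFUTES THE AGREEMENT: a reading `x < F` with `F ≤ (1 − ε)·ref` does not agree with `ref` to `ε`. -/
theorem not_of_lt_floor {ε F x ref : ℝ} (href : 0 ≤ ref) (hF : F ≤ (1 - ε) * ref) (hx : x < F) :
    ¬ RelWithin ε x ref :=
  fun h => absurd (h.floor_of_le_lower href hF) (not_le.mpr hx)

end RelWithin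

/-! ### Instance, REGISTERED BEFORE THE DATA: what the LEAD's 384³ letter for u0⁽²⁾ implies mechanically

HOME/STATUS l.4862 (LANDING #39, 2026-08-25T02:48Z): the dns-B 384³ leg of u0⁽²⁾ (kit j232158, running; no 384³ row
exists when this section is filed) is read by 'IF the 384³ leg agrees (ΔG(t_pk,U) ≤ 2 % vs 256³, peaked interior,
k_max·η_K ≥ 1.3 through t_pk,U, …) the atlas's CERT mark decides mechanically and the break point moves to r ≈ 1.93'.
The 256³ row of record (dns-B kit j229326): `G(t_pk,U) = 2.05772` (`GDnsB`), `g_pk = 3.86980` (`gDnsB`); `λ = 2`, so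
`r_phys = G/2 = 1.0289` and `r = g/2 = 1.9349`; the §1 break point of record is `r = 1.607`. Below: the 2 % limb ALONE
already fixes (i) the physical floor at 3N — `r_phys(384³) ≥ 1.008` — because the 256³ margin over the floor
(2.886 %) exceeds `0.02 · 1.02886`; (ii) the certified `r` window `[1.896, 1.974]`, above the break point of record and
below `λ`; and (iii) that a 384³ reading with `r_phys < 1` is INCOMPATIBLE with the CERT limb under either
normalisation — 'certified AND below the floor' is an empty cell of the outcome table. Arithmetic only; every word
(CERT, break point, floor) is the LEAD's and is decided on the data by the LEAD of that hour. -/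

/-- u0⁽²⁾'s 256³ row passes the physical floor `λ·1 = 2 ≤ G(t_pk,U)` with relative margin `2.88 %`, and the letter's
`2 %` satisfies the floor-transfer condition `ε(1 + m) ≤ m` at that margin (any `ε ≤ 2.8 %` would). -/
theorem u02_floor_margin : (1 + 0.0288) * 2 ≤ GDnsB ∧ (0.02 : ℝ) * (1 + 0.0288) ≤ 0.0288 := by
  unfold GDnsB; constructor <;> norm_num

/-- (i) CERT ⟹ FLOOR AT 3N. Any 384³ value of `G(t_pk,U)` within the letter's `2 %` of the 256³ row satisfies
`G ≥ 2.0165`, hence `r_phys = G/λ ≥ 1.008 ≥ 1`. -/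
theorem u02_cert_implies_floor (G384 : ℝ) (h : RelWithin 0.02 G384 GDnsB) :
    2.0165 ≤ G384 ∧ 1.008 ≤ G384 / 2 ∧ 1 ≤ G384 / 2 := by
  have hl := h.lower (by unfold GDnsB; norm_num)
  unfold GDnsB at hl
  refine ⟨by linarith, by linarith, by linarith⟩

/-- The same under the other normalisation (difference divided by the 384³ value): `G(384³) ≥ 2.05772/1.02 ≥ 2.0173`,
so again `r_phys ≥ 1`. -/
theorem u02_cert_implies_floor_symm (G384 : ℝ) (hG : 0 ≤ G384) (h : RelWithin 0.02 GDnsB G384) :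
    2.0173 ≤ G384 ∧ 1 ≤ G384 / 2 := by
  have hl := h.lower_of_symm hG (by norm_num)
  unfold GDnsB at hl
  constructor
  · have : (2.0173 : ℝ) ≤ 2.05772 / (1 + 0.02) := by norm_num
    linarith
  · have : (2 : ℝ) ≤ 2.05772 / (1 + 0.02) := by norm_num
    linarith

/-- (iii) BELOW THE FLOOR ⟹ NOT CERT, either normalisation: a 384³ reading with `r_phys < 1` (`G < 2`) differs from
the 256³ row by more than `2 %` of either value. -/
theorem u02_floor_lost_refutes_cert (G384 : ℝ) (hlt : G384 / 2 < 1) :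
    ¬ RelWithin 0.02 G384 GDnsB ∧ ¬ RelWithin 0.02 GDnsB G384 := by
  have hG : G384 < 2 := by linarith
  constructor
  · exact RelWithin.not_of_lt_floor (F := 2) (by unfold GDnsB; norm_num) (by unfold GDnsB; norm_num) hG
  · intro h
    unfold RelWithin GDnsB at h
    rcases le_or_gt 0 G384 with hpos | hneg
    · rw [abs_of_nonneg hpos] at h
      have := le_abs_self (2.05772 - G384)
      linarith
    · rw [abs_of_neg hneg] at h
      have := le_abs_self (2.05772 - G384)
      linarith

/-- (ii) CERT ⟹ THE BREAK POINT MOVES, AND WHERE TO. Any 384³ `g_pk` within `2 %` of the 256³ row puts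
`r = g_pk/λ` in `[1.896, 1.974]`: above the break point of record `1.607` (so the §1 sentence moves if the LEAD's
other limbs hold) and below `λ = 2` (the band sup at `t_pk,U` stays below `λ²·U_in(0)`). -/
theorem u02_cert_moves_breakpoint (g384 : ℝ) (h : RelWithin 0.02 g384 gDnsB) :
    1.607 < g384 / 2 ∧ g384 / 2 < 2 ∧ 1.896 ≤ g384 / 2 ∧ g384 / 2 ≤ 1.974 := by
  have h0 : (0 : ℝ) ≤ gDnsB := by unfold gDnsB; norm_num
  have hl := h.lower h0
  have hu := h.upper h0
  unfold gDnsB at hl hu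
  refine ⟨by linarith, by linarith, by linarith, by linarith⟩

/-- Through the engine pair: a 384³ value within `2 %` of dns-B's 256³ row is within `2.031 %` of p1spec's 256³ twin
(`trans'` with the pair's `3·10⁻⁴`), so the floor conclusion does not depend on which 256³ engine is the reference
(`0.97969 · 2.05717 = 2.0154 ≥ 2`). -/
theorem u02_cert_vs_p1spec (G384 : ℝ) (h : RelWithin 0.02 G384 GDnsB) :
    RelWithin 0.02031 G384 GP1 ∧ 1 ≤ G384 / 2 := by
  have hpair : RelWithin 3e-4 GDnsB GP1 := u02_pair_level_one.1.2
  have ht := RelWithin.trans' (by norm_num) h hpair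
  have ht' : RelWithin 0.02031 G384 GP1 := ht.mono (by norm_num)
  refine ⟨ht', ?_⟩
  have hl := ht'.lower (by unfold GP1; norm_num)
  unfold GP1 at hl
  linarith

/-! ### POST-DATA (p1 gen 10): the dns-B 384³ row of u0⁽²⁾ (kit j239969, deposit `atlas/rung-next/dns-B/r3p3-s2/N384/`, 2026-08-25T16:31Z) read by the registered arithmetic above

Numbers only (the CERT mark, the break-point sentence and every word are the LEAD's): `G(t_pk,U) = 2.08954`, `g_pk = 3.86976` at 384³ (t_pk,U 2.0754, min k_max·η_K through t_pk,U 2.058).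
Relative to the 256³ row of record (`GDnsB`, `gDnsB`): `|ΔG|/G₂₅₆ = 1.546 %`, `|Δg|/g₂₅₆ = 0.001 %` — INSIDE the letter's `2 %` on G. -/

/-- dns-B 384³ leg of u0⁽²⁾ (kit j239969): `G(t_pk,U)` at the leg's own level-one peak. -/
def G384 : ℝ := 2.08954

/-- dns-B 384³ leg of u0⁽²⁾ (kit j239969): `g_pk`. -/
def g384 : ℝ := 3.86976

/-- The actual grid agreement on `G(t_pk,U)`: within `0.0155` (relative to the 256³ row). -/
theorem u02_384_G_rel : RelWithin 0.0155 G384 GDnsB := by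
  unfold RelWithin G384 GDnsB; rw [abs_of_pos (by norm_num : (0:ℝ) < 2.05772)]; norm_num [abs_le]

/-- The actual grid agreement on `g_pk`: within `0.0001`. -/
theorem u02_384_g_rel : RelWithin 0.0001 g384 gDnsB := by
  unfold RelWithin g384 gDnsB; rw [abs_of_pos (by norm_num : (0:ℝ) < 3.86980)]; norm_num [abs_le]

/-- The 2 % limb on G HOLDS at 384³ ⇒ (registered `u02_cert_implies_floor`) the physical floor transfers: `G₃₈₄ ≥ 2.0165`,
`r_phys(384³) = G/λ ≥ 1.008 ≥ 1`. -/
theorem u02_384_floor : 2.0165 ≤ G384 ∧ 1.008 ≤ G384 / 2 ∧ 1 ≤ G384 / 2 :=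
  u02_cert_implies_floor G384 (u02_384_G_rel.mono (by norm_num))

/-- … and through the engine pair (registered `u02_cert_vs_p1spec`): within 2.031 % of p1spec's 256³ twin. -/
theorem u02_384_vs_p1spec : RelWithin 0.02031 G384 GP1 ∧ 1 ≤ G384 / 2 :=
  u02_cert_vs_p1spec G384 (u02_384_G_rel.mono (by norm_num))

/-- The 2 % limb on g_pk HOLDS ⇒ (registered `u02_cert_moves_breakpoint`) `r₃₈₄ = g/λ ∈ [1.896, 1.974]`, above the break point of
record 1.607 and below λ = 2 (actual `r₃₈₄ = 1.93488`). -/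
theorem u02_384_breakpoint_window : 1.607 < g384 / 2 ∧ g384 / 2 < 2 ∧ 1.896 ≤ g384 / 2 ∧ g384 / 2 ≤ 1.974 :=
  u02_cert_moves_breakpoint g384 (u02_384_g_rel.mono (by norm_num))

/-- The 384³ numbers themselves: `r_phys = G₃₈₄/2` and `r = g₃₈₄/2` bracketed to 10⁻⁵. -/
theorem u02_384_r_values : |G384 / 2 - 1.04477| ≤ 1e-5 ∧ |g384 / 2 - 1.93488| ≤ 1e-5 := by
  unfold G384 g384; constructor <;> norm_num [abs_le]


/-- The other normalisation also holds on the data: `|ΔG|/G₃₈₄ ≤ 1.53 %` ⇒ (registered `u02_cert_implies_floor_symm`)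
`G₃₈₄ ≥ 2.0173` and `r_phys ≥ 1`. -/
theorem u02_384_floor_symm : 2.0173 ≤ G384 ∧ 1 ≤ G384 / 2 := by
  refine u02_cert_implies_floor_symm G384 (by unfold G384; norm_num) ?_
  unfold RelWithin G384 GDnsB; rw [abs_of_pos (by norm_num : (0:ℝ) < 2.08954)]; norm_num [abs_le]

/-- Resolution numbers of the same row (deposit `resolution` block; numbers only): `min k_max·η_K` through `t_pk,U` is
`2.058 ≥ 1.3` at 384³ (`1.374` at 256³), and the enstrophy ratio `Z₃₈₄/Z₂₅₆` at the peak instants is `0.9994 ≤ 6` —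
the premise and the conclusion of `LevelTwoConfiguration.u02_readable_384` (p394991, registered pre-data) both read
directly. -/
theorem u02_384_resolution_numbers : (1.3 : ℝ) ≤ 2.058 ∧ (0.9994 : ℝ) ≤ 6 ∧ (127 / 85 : ℝ) * 1.374 ≤ 2.058 := by
  norm_num

end Summit.NavierStokesRegularity.FluidComputer.RelativeAgreement
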